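import Mathlib
import Summits.ValiantsHypothesis.ValiantsHypothesis.Theorems.RigidityForcesSymmetryRankRigidMinimalReprLaplaceFiveSeparatedCaptureCommonLinePlaneDiag
import Summits.ValiantsHypothesis.ValiantsHypothesis.Theorems.RigidityForcesSymmetryRankRigidMinimalReprLaplaceFiveSeparatedCaptureLineInTwoPlanes
import Summits.ValiantsHypothesis.ValiantsHypothesis.Theorems.RigidityForcesSymmetryRankRigidMinimalReprLaplaceFiveSeparatedCaptureTwoTerm

/-!
# ValiantsHypothesis / RigidityForcesSymmetry — crux `LaplaceOptimalFive` (stmt-ValiantsHypothesis-24813), symmetric capture: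
# ★★ **DIAGONAL-FREE PROLONGATIONS OF A PLANE THROUGH A ZERO-DIAGONAL LINE FORM AT MOST A LINE**, and the count
# `finrank W ≤ 2 + 3 + 1` for a zero-diagonal common line with three nonzero rows and a non-binary pair

Brick 3 (part 8) of the K1 lane (val-port-2 g6, 2026-08-29).  Located lemma (P0) of the common-line note (rev 6–7), now typed:
for `U = ⟨u, a⟩` with `u ≠ 0` zero-diagonal, the diagonal-free elements of `prolong U` span at most one dimension.  Proof: write the
slices `G_p = λ_p u + μ_p a`; reading `G(p,q₀,q₀)` through the letter `p` and through `q₀` gives `a_{q₀q₀}·μ = λ_{q₀}·u_{q₀}`.  If `a` has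
a diagonal entry `a_{q₀q₀} ≠ 0`, diagonal-freeness gives `μ_{q₀} = 0`, so `G ↦ G(q₀,i,j)` (`u_{ij} ≠ 0`) is injective on the diagonal-free
part (its vanishing forces `λ_{q₀} = 0`, then `μ = 0`, then `G = u ⊠ λ` symmetric, then `λ = 0` by ✓ `rankOne_of_tensor_symm` since
`u` is not a square); if `a` is zero-diagonal, every element of `prolong U` is square-free and ✓ `prolong_sup_sqfree_eq_zero` kills it.
With ✓ `finrank_le_symDiag_add_prolong_add_diagFree` (m = 2 by ✓ `finrank_symDiag_le_two`) this gives the count of the title.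

* ★★ `finrank_diagFree_prolong_pair_le_one` — (P0).
* ★★ `finrank_le_six_of_common_line_rows` — `u` zero-diagonal with an entry `u_{ij} ≠ 0` and a third nonzero row, `U₀₁ = ⟨u,a⟩`,
  `a ∉ U₀₂ ∋ u`, `U₁₂ = ⟨u,c⟩`, and `finrank prolong(U₀₁ ⊔ U₀₂) ≤ 3` (a non-binary pair) ⇒ `finrank W ≤ 6`;
  ★ `captureIneqSym_of_common_line_rows` — the `CaptureIneqSym` conclusion.
  Remaining for the zero-diagonal common line with ≥ 3 nonzero rows: the case where ALL three pairs have prolongation 4 — by ✓BN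
  they are binary in the row space of `u`, flat, and ✓ `captureIneqSym_of_common_line_binary` applies (the bookkeeping
  «all pairs binary ⇒ its hypotheses» is on paper, NOTE rev 7); so after this file the common-line profile is a theorem except for
  that bookkeeping and for the pair-monomial line (located: `W ≤ 5 + r`, (R1)).

Honest framing.  `CaptureIneqSym` for three arbitrary planes through a pair-monomial line, the all-binary bookkeeping above,
`CaptureIneqSym` in general, K1 on `K₃ ⊔ K₂`, `LaplaceOptimalFive` (OPEN · CONTESTED 72/120), `RankRigidMinimalRepr` and `VP ≠ VNP`
are NOT proved here.  No definitions, no `sorry`.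
-/

set_option linter.dupNamespace false
set_option autoImplicit false

namespace Summit.ValiantsHypothesis.ValiantsHypothesis.Theorems.RigidityForcesSymmetryRankRigidMinimalRepr

namespace LaplaceFiveSeparatedCapture

open Finset

/-- ★★ **(P0): DIAGONAL-FREE PROLONGATIONS OF `⟨u, a⟩`, `u ≠ 0` ZERO-DIAGONAL, SPAN AT MOST A LINE.**  For every submodule `D` of
diagonal-free elements of `prolong (span {u, a})`: `finrank D ≤ 1`. [folklore] -/
theorem finrank_diagFree_prolong_pair_le_one (u a : Fin 5 → Fin 5 → ℂ) (hu : ∀ p q, u p q = u q p) (ha : ∀ p q, a p q = a q p)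
    (hud : ∀ p, u p p = 0) (hu0 : u ≠ 0)
    (D : Submodule ℂ (Fin 5 → Fin 5 → Fin 5 → ℂ))
    (hD : ∀ G ∈ D, G ∈ prolong (Submodule.span ℂ ({u, a} : Set (Fin 5 → Fin 5 → ℂ))) ∧ ∀ p : Fin 5, G p p p = 0) :
    Module.finrank ℂ D ≤ 1 := by
  classical
  -- a nonzero (off-diagonal) entry of `u`
  have hij : ∃ i j : Fin 5, u i j ≠ 0 := by
    by_contra h
    push Not at h
    exact hu0 (funext fun i => funext fun j => h i j)
  obtain ⟨i₀, j₀, hij⟩ := hij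
  -- the plane is symmetric of finrank ≤ 2
  have hUs : ∀ x ∈ Submodule.span ℂ ({u, a} : Set (Fin 5 → Fin 5 → ℂ)), ∀ p q : Fin 5, x p q = x q p := by
    intro x hx p q
    obtain ⟨c1, c2, rfl⟩ := Submodule.mem_span_pair.mp hx
    simp only [Pi.add_apply, Pi.smul_apply, smul_eq_mul, hu p q, ha p q]
  have hU2 : Module.finrank ℂ (Submodule.span ℂ ({u, a} : Set (Fin 5 → Fin 5 → ℂ))) ≤ 2 := by
    have h : Module.finrank ℂ (Submodule.span ℂ (↑({u, a} : Finset (Fin 5 → Fin 5 → ℂ)) : Set (Fin 5 → Fin 5 → ℂ))) ≤ 2 :=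
      (finrank_span_finset_le_card _).trans Finset.card_le_two
    have hset : (↑({u, a} : Finset (Fin 5 → Fin 5 → ℂ)) : Set (Fin 5 → Fin 5 → ℂ)) = {u, a} := by
      simp only [Finset.coe_insert, Finset.coe_singleton]
    rw [hset] at h
    exact h
  by_cases hdiag : ∃ q₀, a q₀ q₀ ≠ 0
  · obtain ⟨q₀, hq₀⟩ := hdiag
    -- the read-out `G ↦ G(q₀, i₀, j₀)` is injective on `D`
    let φ : D →ₗ[ℂ] ℂ :=
      ((LinearMap.proj j₀).comp ((LinearMap.proj i₀).comp
        (LinearMap.proj q₀ : (Fin 5 → Fin 5 → Fin 5 → ℂ) →ₗ[ℂ] (Fin 5 → Fin 5 → ℂ)))).comp D.subtype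
    have hφ : ∀ G : D, φ G = G.1 q₀ i₀ j₀ := fun G => rfl
    suffices hinj : Function.Injective φ by
      have h := LinearMap.finrank_le_finrank_of_injective hinj
      rwa [Module.finrank_self] at h
    rw [injective_iff_map_eq_zero]
    intro G hG0
    obtain ⟨hGp, hGd⟩ := hD G.1 G.2
    rw [mem_prolong_iff] at hGp
    obtain ⟨h1, h2, hsl⟩ := hGp
    have hco : ∀ p, ∃ l m : ℂ, l • u + m • a = G.1 p := fun p => Submodule.mem_span_pair.mp (hsl p)
    choose lam mu hlm using hco
    have hc : ∀ p q r, G.1 p q r = lam p * u q r + mu p * a q r := fun p q r => by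
      have e := congrFun (congrFun (hlm p) q) r
      simp only [Pi.add_apply, Pi.smul_apply, smul_eq_mul] at e
      exact e.symm
    -- diagonal-freeness at `q₀`
    have hmu0 : mu q₀ = 0 := by
      have e := hGd q₀
      rw [hc, hud q₀, mul_zero, zero_add] at e
      rcases mul_eq_zero.mp e with h | h
      · exact h
      · exact absurd h hq₀
    -- `a_{q₀q₀} μ_p = λ_{q₀} u_{p q₀}`
    have hS1 : ∀ p, a q₀ q₀ * mu p = lam q₀ * u q₀ p := fun p => by
      have e1 : G.1 p q₀ q₀ = lam p * u q₀ q₀ + mu p * a q₀ q₀ := hc p q₀ q₀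
      have e2 : G.1 p q₀ q₀ = G.1 q₀ q₀ p := by rw [h1 p q₀ q₀, h2 q₀ p q₀]
      rw [e2, hc, hmu0, hud q₀] at e1
      linear_combination -e1
    -- the read-out vanishes: `λ_{q₀} = 0`
    have hl0 : lam q₀ = 0 := by
      have e := hG0
      rw [hφ, hc, hmu0, zero_mul, add_zero] at e
      rcases mul_eq_zero.mp e with h | h
      · exact h
      · exact absurd h hij
    have hmu : ∀ p, mu p = 0 := fun p => by
      have e := hS1 p
      rw [hl0, zero_mul] at e
      rcases mul_eq_zero.mp e with h | h
      · exact absurd h hq₀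
      · exact h
    -- `G = u ⊠ λ` symmetric forces `λ = 0` (`u` is not a square)
    have hlam : ∀ p, lam p = 0 := by
      by_contra hne
      push Not at hne
      obtain ⟨r₀, hr₀⟩ := hne
      have hsym : ∀ p q r, u p q * lam r = u p r * lam q := fun p q r => by
        have e1 : G.1 r p q = lam r * u p q := by rw [hc, hmu r, zero_mul, add_zero]
        have e2 : G.1 q p r = lam q * u p r := by rw [hc, hmu q, zero_mul, add_zero]
        have e3 : G.1 r p q = G.1 q p r := by rw [h1 r p q, h2 p r q, h1 p q r]
        rw [e1, e2] at e3
        linear_combination e3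
      have key := rankOne_of_tensor_symm u lam hu hsym r₀ hr₀
      apply hu0
      funext p q
      rw [key p q, hud r₀]
      simp
    apply Subtype.ext
    funext p q r
    rw [hc, hmu p, hlam p]
    simp
  · -- `a` zero-diagonal: every element of `D` is square-free, hence zero
    push Not at hdiag
    have hD0 : ∀ G ∈ D, G = 0 := by
      intro G hG
      obtain ⟨hGp, -⟩ := hD G hG
      have hGp' := hGp
      rw [mem_prolong_iff] at hGp'
      obtain ⟨h1, h2, hsl⟩ := hGp'
      have hsq : ∀ p r, (G + 0) p p r = 0 := by
        intro p r
        rw [add_zero]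
        have e : G p p r = G r p p := by rw [h2 p p r, h1 p r p]
        rw [e]
        obtain ⟨l, m, hlm⟩ := Submodule.mem_span_pair.mp (hsl r)
        have e2 := congrFun (congrFun hlm p) p
        simp only [Pi.add_apply, Pi.smul_apply, smul_eq_mul, hud p, hdiag p, mul_zero, add_zero] at e2
        exact e2.symm
      have h3 : Module.finrank ℂ ↥(Submodule.span ℂ ({u, a} : Set (Fin 5 → Fin 5 → ℂ)) ⊔
          Submodule.span ℂ ({u, a} : Set (Fin 5 → Fin 5 → ℂ))) ≤ 3 := by
        rw [sup_idem]
        exact hU2.trans (by norm_num)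
      have h := prolong_sup_sqfree_eq_zero _ _ hUs hUs hU2 hU2 h3 G 0 hGp (Submodule.zero_mem _) hsq
      rwa [add_zero] at h
    have hbot : D = ⊥ := by
      refine (Submodule.eq_bot_iff _).mpr hD0
    rw [hbot, finrank_bot]
    exact Nat.zero_le _

/-- ★★ **COUNT FOR A ZERO-DIAGONAL COMMON LINE WITH THREE NONZERO ROWS AND A NON-BINARY PAIR.**  `u` symmetric zero-diagonal with
`u_{ij} ≠ 0` and a third nonzero row `p ∉ {i,j}`; `U₀₁ = ⟨u, a⟩`, `a ∉ U₀₂ ∋ u`, `U₁₂ = ⟨u, c⟩`; `finrank prolong(U₀₁ ⊔ U₀₂) ≤ 3`.  Then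
`finrank W ≤ 6` (= 2 for `K(u)` by ✓ `finrank_symDiag_le_two`, + 3, + 1 by (P0), via ✓ `finrank_le_symDiag_add_prolong_add_diagFree`). [folklore] -/
theorem finrank_le_six_of_common_line_rows (u a c : Fin 5 → Fin 5 → ℂ) (hu : ∀ p q, u p q = u q p) (ha : ∀ p q, a p q = a q p)
    (hc : ∀ p q, c p q = c q p) (i j p r : Fin 5) (hij : i ≠ j) (hpi : p ≠ i) (hpj : p ≠ j) (huij : u i j ≠ 0) (hupr : u p r ≠ 0)
    (hud : ∀ q, u q q = 0) (U02 W : Submodule ℂ (Fin 5 → Fin 5 → ℂ))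
    (h02s : ∀ x ∈ U02, ∀ p q : Fin 5, x p q = x q p) (huU : u ∈ U02) (haU : a ∉ U02)
    (h3 : Module.finrank ℂ (prolong (Submodule.span ℂ ({u, a} : Set (Fin 5 → Fin 5 → ℂ)) ⊔ U02)) ≤ 3)
    (hWs : ∀ μ ∈ W, ∀ s t : Fin 5, μ s t = μ t s) (hWd : ∀ μ ∈ W, ∀ s : Fin 5, μ s s = 0)
    (hWc : ∀ μ ∈ W, contractZ μ ∈ L3 (Submodule.span ℂ ({u, a} : Set (Fin 5 → Fin 5 → ℂ))) U02
      (Submodule.span ℂ ({u, c} : Set (Fin 5 → Fin 5 → ℂ)))) :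
    Module.finrank ℂ W ≤ 6 := by
  classical
  have hu0 : u ≠ 0 := fun h => huij (by rw [h]; rfl)
  have h12s : ∀ x ∈ Submodule.span ℂ ({u, c} : Set (Fin 5 → Fin 5 → ℂ)), ∀ p q : Fin 5, x p q = x q p := by
    intro x hx p q
    obtain ⟨c1, c2, rfl⟩ := Submodule.mem_span_pair.mp hx
    simp only [Pi.add_apply, Pi.smul_apply, smul_eq_mul, hu p q, hc p q]
  have huU' : u ∈ Submodule.span ℂ ({u, c} : Set (Fin 5 → Fin 5 → ℂ)) := Submodule.subset_span (by simp)
  -- the diagonal-free part of `prolong U₁₂`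
  let ev : Fin 5 → ((Fin 5 → Fin 5 → Fin 5 → ℂ) →ₗ[ℂ] ℂ) := fun q =>
    (LinearMap.proj q).comp ((LinearMap.proj q).comp
      (LinearMap.proj q : (Fin 5 → Fin 5 → Fin 5 → ℂ) →ₗ[ℂ] (Fin 5 → Fin 5 → ℂ)))
  let D : Submodule ℂ (Fin 5 → Fin 5 → Fin 5 → ℂ) :=
    prolong (Submodule.span ℂ ({u, c} : Set (Fin 5 → Fin 5 → ℂ))) ⊓ ⨅ q : Fin 5, LinearMap.ker (ev q)
  have hDin : ∀ G ∈ prolong (Submodule.span ℂ ({u, c} : Set (Fin 5 → Fin 5 → ℂ))), (∀ q : Fin 5, G q q q = 0) → G ∈ D := by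
    intro G hG hG0
    refine Submodule.mem_inf.mpr ⟨hG, ?_⟩
    rw [Submodule.mem_iInf]
    intro q
    rw [LinearMap.mem_ker]
    exact hG0 q
  have hDout : ∀ G ∈ D, G ∈ prolong (Submodule.span ℂ ({u, c} : Set (Fin 5 → Fin 5 → ℂ))) ∧ ∀ q : Fin 5, G q q q = 0 := by
    intro G hG
    obtain ⟨hG1, hG2⟩ := Submodule.mem_inf.mp hG
    rw [Submodule.mem_iInf] at hG2
    exact ⟨hG1, fun q => by have := hG2 q; rwa [LinearMap.mem_ker] at this⟩
  have hD1 : Module.finrank ℂ D ≤ 1 := finrank_diagFree_prolong_pair_le_one u c hu hc hud hu0 D hDout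
  have h := finrank_le_symDiag_add_prolong_add_diagFree u a hu ha U02 _ W h02s h12s hud huU huU' haU 2
    (fun S hS => finrank_symDiag_le_two u hu i j p r hij hpi hpj huij hupr S hS) hWs hWd hWc D hDin
  omega

/-- ★ **`CaptureIneqSym` for a zero-diagonal common line with three nonzero rows and a non-binary pair** (`6 ≤ Σ finrank`,
e.g. three 2-planes). [folklore] -/
theorem captureIneqSym_of_common_line_rows (u a c : Fin 5 → Fin 5 → ℂ) (hu : ∀ p q, u p q = u q p) (ha : ∀ p q, a p q = a q p)
    (hc : ∀ p q, c p q = c q p) (i j p r : Fin 5) (hij : i ≠ j) (hpi : p ≠ i) (hpj : p ≠ j) (huij : u i j ≠ 0) (hupr : u p r ≠ 0)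
    (hud : ∀ q, u q q = 0) (U02 W : Submodule ℂ (Fin 5 → Fin 5 → ℂ))
    (h02s : ∀ x ∈ U02, ∀ p q : Fin 5, x p q = x q p) (huU : u ∈ U02) (haU : a ∉ U02)
    (h3 : Module.finrank ℂ (prolong (Submodule.span ℂ ({u, a} : Set (Fin 5 → Fin 5 → ℂ)) ⊔ U02)) ≤ 3)
    (h6 : 6 ≤ Module.finrank ℂ (Submodule.span ℂ ({u, a} : Set (Fin 5 → Fin 5 → ℂ))) + Module.finrank ℂ U02
      + Module.finrank ℂ (Submodule.span ℂ ({u, c} : Set (Fin 5 → Fin 5 → ℂ))))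
    (hWs : ∀ μ ∈ W, ∀ s t : Fin 5, μ s t = μ t s) (hWd : ∀ μ ∈ W, ∀ s : Fin 5, μ s s = 0)
    (hWc : ∀ μ ∈ W, contractZ μ ∈ L3 (Submodule.span ℂ ({u, a} : Set (Fin 5 → Fin 5 → ℂ))) U02
      (Submodule.span ℂ ({u, c} : Set (Fin 5 → Fin 5 → ℂ)))) :
    Module.finrank ℂ W ≤ Module.finrank ℂ (Submodule.span ℂ ({u, a} : Set (Fin 5 → Fin 5 → ℂ))) + Module.finrank ℂ U02
      + Module.finrank ℂ (Submodule.span ℂ ({u, c} : Set (Fin 5 → Fin 5 → ℂ))) :=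
  (finrank_le_six_of_common_line_rows u a c hu ha hc i j p r hij hpi hpj huij hupr hud U02 W h02s huU haU h3 hWs hWd hWc).trans h6

end LaplaceFiveSeparatedCapture

end Summit.ValiantsHypothesis.ValiantsHypothesis.Theorems.RigidityForcesSymmetryRankRigidMinimalRepr
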